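import Summits.BirchSwinnertonDyer.Rank1Residual.P2.CMKolyvaginOddManinTwistRoadAtTwo
import Summits.BirchSwinnertonDyer.Rank1Residual.P2.CornerFTwoModelLocalTwo
import HarnessLib

/-!
# Route `ShiftedKolyvaginAtInertTwo` (leaf `WAllCornerFTwo`), crux `OddManinCMInertTwoR`
# (stmt-BirchSwinnertonDyer-26780): THE CLASS DOOR — on the five odd-Heegner classes every
# lattice-optimal `X₀(N)`-datum has odd Manin constant, modulo four printed facts

Cell `bsd-print-cf2`, seat ty2 (discharge interface). Sequel of `CMKolyvaginOddManinTwistRoadAtTwo.lean`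
(the engine `odd_c_of_latticeOptimal_of_smul_eq_quadraticTwist_of_hasGoodReductionAtPrime_two`: every
square-free quadratic twist of a globally minimal base GOOD at `2`, via the dyadic twist road — Barrios
et al. 2025 Thm. 5.1, Stevens 1989 §5 on `Γ₀`, cell `bsd-f2-manin`'s proved `η = 2` law). HONEST
FRAMING: THEOREMS ONLY — no definition, no named fact, no route file imported, nothing about BSD
asserted or booked; the leaf, the route's research cruxes and crux 26780 AS TYPED (whole habitat `H₂`)
are OPEN; Manin's conjecture and BSD are NOT proved by any of this.

* the five bases `121b1, 361a1, 1849a1, 4489a1, 26569a1` are good at `2` — tree theorems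
  `CornerFTwo.Atlas.good_two_cm11` … `good_two_cm163` (`CornerFTwoModelLocalTwo.lean`).
* `odd_c_of_latticeOptimal_of_j_oddHeegner` — THE CLASS DOOR: `W` globally minimal with
  `j(W) ∈ {−2¹⁵, −2¹⁵3³, −2¹⁸3³5³, −2¹⁵3³5³11³, −2¹⁸3³5³23³29³}` and ANY lattice-optimal datum `Dt` at
  any level ⟹ `Odd Dt.c`, modulo `hM` (Mazur 1978 Cor. 4.1), `hAU` (Abbes–Ullmo 1996 Thm. A), `hC2`
  (Česnavičius 2018 Thm. 1.2), `hnf` (modularity) — by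
  `exists_variableChange_eq_quadraticTwist_intCast_of_j_eq` (`W ≅ cm_q^{(d)}`, `d` square-free) and the
  engine.
* `oddManinCMInertTwoR_of_j_oddHeegner_of_print` — the BODY OF CRUX 26780 VERBATIM (habitat binders,
  `Dt` at the conductor, lattice clause, `Odd Dt.c`) with the one extra binder `j(W) ∈ five` that the
  route's `closes` (rev 11) holds at its call site `intro W _ _ _ Dt hoptDt hr hj` — modulo the four
  prints. TURNKEY for the planner: restate 26780 with `hj`, or replace the crux by the three Manin print
  binders and call `odd_c_of_latticeOptimal_of_j_oddHeegner hM hAU hC2 hmod W hj Dt hoptDt` in `closes`.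

NOT covered: the `j = 0` sector of `H₂` (crux 26780 as typed), see the sibling file's docstring.

References: [Stevens1989] Lemmas (5.2), (5.4); [Cesnavicius2018] Thm. 1.2; [Mazur1978] Cor. 4.1;
[AbbesUllmo1996] Thm. A; [BarriosEtAl2025] Thm. 5.1; [SilvermanATAEC1994] App. A §3;
[SilvermanAEC2009] VII.1 Rem. 1.1, X.5 Cor. 5.4.1; [Cremona1997] Table 1.
-/

set_option autoImplicit false

noncomputable section

open scoped Classical

open WeierstrassCurve Literature.NumberTheory.EllipticCurves Literature.NumberTheory.EllipticCurves.ModularForms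
  Summit.BirchSwinnertonDyer.Rank1Residual.P2

namespace Summit.BirchSwinnertonDyer.Rank1Residual.P2.OddManinTwistRoad

/-! ## §4 The class door on the five odd-Heegner classes, and crux 26780's shape -/

/-- **THE CLASS DOOR.** For `W/ℚ` globally minimal with one of the five odd-Heegner `j`-invariants
(every quadratic twist of `121b1, 361a1, 1849a1, 4489a1, 26569a1`) and EVERY lattice-optimal
`X₀(N)`-datum `Dt` of `W` at any level (`Λ_W ⊆ c·Λ_f`, i.e. `W` optimal in its class with Manin
constant `c`): `c` is ODD — modulo the printed facts Mazur 1978 Cor. 4.1 (`hM`), Abbes–Ullmo 1996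
Thm. A (`hAU`), Česnavičius 2018 Thm. 1.2 (`hC2`) and modularity (`hnf`), by name. The 2-part of
Manin's conjecture on these five CM classes, via the dyadic twist road (§3) on each base (good at `2`).
[cite: Stevens1989, Lemmas (5.2), (5.4), (5.6)–(5.7) pp. 96–98] [cite: Cesnavicius2018, Thm. 1.2]
[cite: Mazur1978, Cor. 4.1] [cite: AbbesUllmo1996, Thm. A] [cite: BarriosEtAl2025, Thm. 5.1]
[cite: SilvermanATAEC1994, App. A §3 (table of CM j-invariants)] -/
theorem odd_c_of_latticeOptimal_of_j_oddHeegner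
    (hM : mazur_not_dvd_maninConstant_of_odd)
    (hAU : abbesUllmo_not_dvd_maninConstant_of_not_dvd_level)
    (hC2 : cesnavicius_not_two_dvd_maninConstant_of_two_dvd_level) (hnf : exists_isNewformOf)
    (W : WeierstrassCurve ℚ) [W.IsElliptic] [W.IsGloballyMinimal]
    (hj : W.j = -32768 ∨ W.j = -884736 ∨ W.j = -884736000 ∨ W.j = -147197952000 ∨
      W.j = -262537412640768000)
    {N : ℕ} [NeZero N] (Dt : ModularParametrizationData W N)
    (hopt : ∀ z ∈ Dt.L.lattice, ∃ w ∈ periodLattice Dt.f, z = (Dt.c : ℂ) * w) : Odd Dt.c := by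
  rcases hj with h | h | h | h | h
  · haveI : cm11.IsGloballyMinimal := OddHeegnerTwists.isGloballyMinimal_cm11
    exact odd_c_of_latticeOptimal_of_j_eq_of_hasGoodReductionAtPrime_two hM hAU hC2 hnf cm11
      CornerFTwo.Atlas.good_two_cm11 (by rw [j_cm11]; norm_num) (by rw [j_cm11]; norm_num) W
      (h.trans j_cm11.symm) Dt hopt
  · haveI : cm19.IsGloballyMinimal := OddHeegnerTwists.isGloballyMinimal_cm19
    exact odd_c_of_latticeOptimal_of_j_eq_of_hasGoodReductionAtPrime_two hM hAU hC2 hnf cm19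
      CornerFTwo.Atlas.good_two_cm19 (by rw [j_cm19]; norm_num) (by rw [j_cm19]; norm_num) W
      (h.trans j_cm19.symm) Dt hopt
  · haveI : cm43.IsGloballyMinimal := OddHeegnerTwists.isGloballyMinimal_cm43
    exact odd_c_of_latticeOptimal_of_j_eq_of_hasGoodReductionAtPrime_two hM hAU hC2 hnf cm43
      CornerFTwo.Atlas.good_two_cm43 (by rw [j_cm43]; norm_num) (by rw [j_cm43]; norm_num) W
      (h.trans j_cm43.symm) Dt hopt
  · haveI : cm67.IsGloballyMinimal := OddHeegnerTwists.isGloballyMinimal_cm67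
    exact odd_c_of_latticeOptimal_of_j_eq_of_hasGoodReductionAtPrime_two hM hAU hC2 hnf cm67
      CornerFTwo.Atlas.good_two_cm67 (by rw [j_cm67]; norm_num) (by rw [j_cm67]; norm_num) W
      (h.trans j_cm67.symm) Dt hopt
  · haveI : cm163.IsGloballyMinimal := OddHeegnerTwists.isGloballyMinimal_cm163
    exact odd_c_of_latticeOptimal_of_j_eq_of_hasGoodReductionAtPrime_two hM hAU hC2 hnf cm163
      CornerFTwo.Atlas.good_two_cm163 (by rw [j_cm163]; norm_num) (by rw [j_cm163]; norm_num) W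
      (h.trans j_cm163.symm) Dt hopt

/-- **CRUX 26780 `OddManinCMInertTwoR` ON THE SLICE `closes` CONSUMES, BY NAME.** The body of the crux
(route `ShiftedKolyvaginAtInertTwo`, rev 11) VERBATIM — binders `W.HasCM`, `CMInert W 2`,
`W.HasSurjectiveModNGaloisRep 2`, `W.analyticRank = 1`, `Dt` at the conductor, the lattice clause — with
the one extra binder `j(W) ∈ five` that `closes` holds at the call site (`intro W _ _ _ Dt hoptDt hr hj`),
modulo the four printed facts. The habitat binders are not used. TURNKEY for the planner: restate 26780
with `hj` (then this theorem closes it), or replace the crux by the print binders `hM hAU hC2` and call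
`odd_c_of_latticeOptimal_of_j_oddHeegner hM hAU hC2 hmod W hj Dt hoptDt` inside `closes`.
[cite: Stevens1989, Lemmas (5.2), (5.4)] [cite: Cesnavicius2018, Thm. 1.2] [cite: Mazur1978, Cor. 4.1]
[cite: AbbesUllmo1996, Thm. A] [cite: BarriosEtAl2025, Thm. 5.1] -/
theorem oddManinCMInertTwoR_of_j_oddHeegner_of_print
    (hM : mazur_not_dvd_maninConstant_of_odd)
    (hAU : abbesUllmo_not_dvd_maninConstant_of_not_dvd_level)
    (hC2 : cesnavicius_not_two_dvd_maninConstant_of_two_dvd_level) (hnf : exists_isNewformOf) :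
    ∀ (W : WeierstrassCurve ℚ) [W.IsElliptic] [W.IsGloballyMinimal] [NeZero (W.conductorNorm ℤ)],
      (W.j = -32768 ∨ W.j = -884736 ∨ W.j = -884736000 ∨ W.j = -147197952000 ∨
        W.j = -262537412640768000) →
      W.HasCM → Literature.NumberTheory.EllipticCurves.Rank1Residual.CMInert W 2 →
      W.HasSurjectiveModNGaloisRep (2 : ℤ) → W.analyticRank = 1 →
      ∀ (Dt : ModularParametrizationData W (W.conductorNorm ℤ)),
        (∀ z ∈ Dt.L.lattice, ∃ w ∈ periodLattice Dt.f, z = (Dt.c : ℂ) * w) → Odd Dt.c :=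
  fun W _ _ _ hj _ _ _ _ Dt hopt ↦ odd_c_of_latticeOptimal_of_j_oddHeegner hM hAU hC2 hnf W hj Dt hopt

/-- **THE SAME IN THE ROUTE'S `…OfFacts` ITEM SHAPE** (one conjunctive antecedent of the four printed
facts, then the body of crux 26780 verbatim with the extra binder `j(W) ∈ five`): the text a planner can
file as the restated crux `OddManinCMInertTwoOfFacts`, closable BY NAME by this theorem; `closes` then
reads `have hc : Odd Dt.c := hMan ⟨hMz, hAU, hC2, hmod⟩ W hj hcm hin hρ hr Dt hoptDt` with three print
support binders `hMz hAU hC2` (Mazur 1978 Cor. 4.1 / Abbes–Ullmo 1996 Thm. A / Česnavičius 2018 Thm. 1.2,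
the Literature named facts `mazur_not_dvd_maninConstant_of_odd`,
`abbesUllmo_not_dvd_maninConstant_of_not_dvd_level`, `cesnavicius_not_two_dvd_maninConstant_of_two_dvd_level`)
next to the route's `hmod : ModularityExistsNewform`. [cite: Stevens1989, Lemmas (5.2), (5.4)]
[cite: Cesnavicius2018, Thm. 1.2] [cite: Mazur1978, Cor. 4.1] [cite: AbbesUllmo1996, Thm. A]
[cite: BarriosEtAl2025, Thm. 5.1] -/
theorem oddManinCMInertTwo_ofFacts :
    (Literature.NumberTheory.EllipticCurves.ModularForms.mazur_not_dvd_maninConstant_of_odd ∧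
      Literature.NumberTheory.EllipticCurves.ModularForms.abbesUllmo_not_dvd_maninConstant_of_not_dvd_level ∧
      Literature.NumberTheory.EllipticCurves.ModularForms.cesnavicius_not_two_dvd_maninConstant_of_two_dvd_level ∧
      Literature.NumberTheory.EllipticCurves.ModularForms.exists_isNewformOf) →
    ∀ (W : WeierstrassCurve ℚ) [W.IsElliptic] [W.IsGloballyMinimal] [NeZero (W.conductorNorm ℤ)],
      (W.j = -32768 ∨ W.j = -884736 ∨ W.j = -884736000 ∨ W.j = -147197952000 ∨
        W.j = -262537412640768000) →
      W.HasCM → Literature.NumberTheory.EllipticCurves.Rank1Residual.CMInert W 2 →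
      W.HasSurjectiveModNGaloisRep (2 : ℤ) → W.analyticRank = 1 →
      ∀ (Dt : Literature.NumberTheory.EllipticCurves.ModularForms.ModularParametrizationData W
        (W.conductorNorm ℤ)),
        (∀ z ∈ Dt.L.lattice, ∃ w ∈ Literature.NumberTheory.EllipticCurves.ModularForms.periodLattice Dt.f,
          z = (Dt.c : ℂ) * w) → Odd Dt.c :=
  fun h W _ _ _ hj _ _ _ _ Dt hopt ↦
    odd_c_of_latticeOptimal_of_j_oddHeegner h.1 h.2.1 h.2.2.1 h.2.2.2 W hj Dt hopt

end Summit.BirchSwinnertonDyer.Rank1Residual.P2.OddManinTwistRoad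

end
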